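import Summits.Ventures.HSemireg.WedgeCarrierEclDividedPowers
import Summits.Ventures.HSemireg.Mod4CarrierWeilSquare
import Literature.LinearAlgebra.Alternating.ExteriorAlgebraDirectSum
import Mathlib.LinearAlgebra.ExteriorAlgebra.Grading

/-!
# Venture HSemireg — the MUKAI PAIRING ON THE CARRIER: `Ecl` is multiplicative for the binomial convolution, `Θ` kills the
# Weil vectors, and the top-degree part of `v^∨ · v` for `v = Ecl q (2n) + a·w₊ + b·w₋` is `(P_f(q) + 2ab) · Θ^{2n}/(2n)!`

HONEST FRAMING. Part of the Lean index of the computation cell `pub-hsemireg` (seat w3-mod4-1 gen 9, W3 SPECIAL FIBRES,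
MOD4-OFFSPLIT §1 LEMMA HRR-SPLIT / §13). Finite-dimensional exterior algebra over a field ONLY (p4's carrier in an adapted frame
`bV`: `Θ = Σ_a ℓ_a ∧ m_a`, `Ecl q N = Σ_m q_m Θ^m/m!`, `wUp`/`wLow` the block top forms, `LMprod N = Θ^N/N!`): no variety, no
cohomology theory, no Euler characteristic of any sheaf, no integral `∫` is constructed here; nothing here says that HC / HC_CM /
HC_AV holds; no Literature fact is declared; NO definition is introduced. What this file does NOT contain: the reading
`∫ Θ^{2n}/(2n)! = D` and the Hodge–Riemann sign `(w,w)_χ > 0` — the two non-algebraic inputs of HRR-SPLIT stay pencil.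

WHAT IS PROVED (every field unless stated).
* **`Ecl_mul_Ecl`** — `Ecl q k · Ecl q' k = Ecl (q ⋆ q') k` with the BINOMIAL CONVOLUTION `(q ⋆ q')_s = Σ_{j ≤ s} C(s,j) q_j q'_{s-j}`
  (written out; `Ecl` is the exponential generating structure `Σ_S q_{|S|} Π_{a ∈ S} ℓ_a ∧ m_a`); `Ecl_comm` (`Ecl` is central).
* homogeneity: `LM_mem_pow`, `layer_mem_pow` (`Ecl δ_m k ∈ ⋀^{2m}`), `vac_mem_pow`, `ellprod_mem_pow`, `ellprodFrom_mem_pow`,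
  `vacFrom_mem_pow`, `wUp_mem_pow` / `wLow_mem_pow` (`∈ ⋀^N`), `LMprod_mem_pow` (`∈ ⋀^{2N}`); `proj_Ecl_top`: the degree-`2N`
  component of `Ecl Q N` is `Q_N · LMprod N`.
* **`Θ` KILLS THE WEIL VECTORS**: `LM_mul_wUp`, `LM_mul_wLow` (`(ℓ_a ∧ m_a) · w± = 0`, `a < N`, `p ≤ N`), hence `Ecl_mul_wUp` /
  `Ecl_mul_wLow`: `Ecl Q k · w± = Q_0 · w±` (`k ≤ N`) («`h · W_K = 0`», the primitivity of the Weil classes, in the frame).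
* **`proj_mukaiDual_mul_top`** (Weil type `(n,n)`, `n ≥ 1`): for `v = Ecl q (2n) + a·w₊ + b·w₋` and its MUKAI DUAL VECTOR
  `v^∨ := Ecl q̃ (2n) + (-1)ⁿ·(a·w₊ + b·w₋)`, `q̃_m = (-1)^m q_m` (i.e. `f(-h) + (-1)ⁿ w`, written out), the degree-`4n` component of
  `v^∨ · v` is `(Σ_{j ≤ 2n} (-1)^j C(2n,j) q_j q_{2n-j} + 2ab) · LMprod (2n)` — the sheet's `χ_HRR(v) = D·P_f(q) + (w,w)_χ` BEFORE `∫`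
  (`(w,w)_χ ↔ 2ab·D`; in τ-form `ab = (-1)ⁿ t` when `w ∧ w = 2t·Θ^{2n}/(2n)!`, `Mod4Carrier.eq_of_weil_sq_nn`).
Everything PROVED, 0 sorry.
References: [BourbakiAlgebre1a3] Ch. III §7 no. 1, no. 8; [BuchweitzFlenner2008HH] Prop. 6.4.4; [MumfordAV1970] §16 (RR).
-/

noncomputable section

open ExteriorAlgebra (ι)
open Module

namespace Summit.Ventures.HSemireg.WeilFrame

open Summit.Ventures.HSemireg.WedgeBridge Summit.Ventures.HSemireg.WeilCarrier Summit.Ventures.HSemireg.Mod4Carrier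
open Literature.LinearAlgebra.Alternating (ι_mem_exteriorPower_one)

variable {K : Type*} [Field K] {V : Type*} [AddCommGroup V] [Module K V]

section Carrier

variable {N : ℕ} (bV : Basis (Fin (N + N)) K V)

/-! ### 1. `Ecl` is multiplicative for the binomial convolution -/

/-- Pascal for the binomial convolution: `(q ⋆ q')_{s+1} = (q ⋆ σq')_s + (σq ⋆ q')_s`, `σ` the shift. -/
lemma binomialConv_succ (q q' : ℕ → K) (s : ℕ) :
    ∑ j ∈ Finset.range (s + 1 + 1), (((s + 1).choose j : ℕ) : K) * (q j * q' (s + 1 - j)) =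
      ∑ j ∈ Finset.range (s + 1), ((s.choose j : ℕ) : K) * (q j * q' (s - j + 1)) +
        ∑ j ∈ Finset.range (s + 1), ((s.choose j : ℕ) : K) * (q (j + 1) * q' (s - j)) := by
  rw [Finset.sum_range_succ' _ (s + 1)]
  have h1 : ∀ j ∈ Finset.range (s + 1), (((s + 1).choose (j + 1) : ℕ) : K) * (q (j + 1) * q' (s + 1 - (j + 1))) =
      ((s.choose (j + 1) : ℕ) : K) * (q (j + 1) * q' (s - (j + 1) + 1)) + ((s.choose j : ℕ) : K) * (q (j + 1) * q' (s - j)) := by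
    intro j hj
    rw [Finset.mem_range] at hj
    rw [Nat.choose_succ_succ', Nat.cast_add, add_mul, add_comm, show s + 1 - (j + 1) = s - j by omega]
    by_cases hjs : j + 1 ≤ s
    · rw [show s - (j + 1) + 1 = s - j by omega]
    · rw [Nat.choose_eq_zero_of_lt (by omega), Nat.cast_zero, zero_mul, zero_mul]
  rw [Finset.sum_congr rfl h1, Finset.sum_add_distrib, Nat.choose_zero_right, Nat.sub_zero,
    Finset.sum_range_succ' (fun j => ((s.choose j : ℕ) : K) * (q j * q' (s - j + 1))) s, Nat.choose_zero_right, Nat.sub_zero,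
    Finset.sum_range_succ (fun j => ((s.choose (j + 1) : ℕ) : K) * (q (j + 1) * q' (s - (j + 1) + 1))) s,
    Nat.choose_succ_self, Nat.cast_zero, zero_mul, add_zero]
  abel

/-- **`Ecl` IS MULTIPLICATIVE FOR THE BINOMIAL CONVOLUTION:** `Ecl q k · Ecl q' k = Ecl (q ⋆ q') k`,
`(q ⋆ q')_s = Σ_{j ≤ s} C(s,j) q_j q'_{s-j}` (every field, every `k`). [cite: BourbakiAlgebre1a3, Ch. III §7 no. 1] -/
theorem Ecl_mul_Ecl : ∀ (k : ℕ) (q q' : ℕ → K),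
    Ecl bV q k * Ecl bV q' k =
      Ecl bV (fun s => ∑ j ∈ Finset.range (s + 1), ((s.choose j : ℕ) : K) * (q j * q' (s - j))) k
  | 0, q, q' => by
    rw [Ecl, Ecl, Ecl, ← map_mul, zero_add, Finset.sum_range_one, Nat.choose_self, Nat.cast_one, one_mul, Nat.sub_zero]
  | k + 1, q, q' => by
    have hL2 : LM bV k * LM bV k = 0 := LM_mul_self bV k
    have hshift : (fun s => ∑ j ∈ Finset.range (s + 1 + 1), (((s + 1).choose j : ℕ) : K) * (q j * q' (s + 1 - j))) =
        fun s => (fun s => ∑ j ∈ Finset.range (s + 1), ((s.choose j : ℕ) : K) * (q j * q' (s - j + 1))) s +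
          (fun s => ∑ j ∈ Finset.range (s + 1), ((s.choose j : ℕ) : K) * (q (j + 1) * q' (s - j))) s :=
      funext fun s => binomialConv_succ q q' s
    have e1 : Ecl bV q k * (LM bV k * Ecl bV (fun j => q' (j + 1)) k) =
        LM bV k * (Ecl bV q k * Ecl bV (fun j => q' (j + 1)) k) := by
      rw [← mul_assoc, ← LM_comm bV k (Ecl bV q k), mul_assoc]
    have e2 : LM bV k * Ecl bV (fun j => q (j + 1)) k * (LM bV k * Ecl bV (fun j => q' (j + 1)) k) = 0 := by
      rw [mul_assoc, ← mul_assoc (Ecl bV (fun j => q (j + 1)) k), ← LM_comm bV k (Ecl bV (fun j => q (j + 1)) k),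
        mul_assoc, ← mul_assoc (LM bV k) (LM bV k), hL2, zero_mul]
    rw [Ecl, Ecl, Ecl, add_mul, mul_add, mul_add, e1, e2, add_zero, mul_assoc (LM bV k) (Ecl bV (fun j => q (j + 1)) k),
      Ecl_mul_Ecl k q q', Ecl_mul_Ecl k q (fun j => q' (j + 1)), Ecl_mul_Ecl k (fun j => q (j + 1)) q', hshift, Ecl_add,
      mul_add]
    abel

/-- `Ecl q k` is central. -/
lemma Ecl_comm : ∀ (k : ℕ) (q : ℕ → K) (x : ExteriorAlgebra K V), Ecl bV q k * x = x * Ecl bV q k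
  | 0, q, x => by rw [Ecl]; exact Algebra.commutes _ _
  | k + 1, q, x => by rw [Ecl, add_mul, mul_add, Ecl_comm k q x, mul_assoc, Ecl_comm k _ x, ← mul_assoc, LM_comm, mul_assoc]

/-! ### 2. Homogeneity of the carrier words -/

-- `ι v ∈ ⋀¹` is the tree's `Literature.LinearAlgebra.Alternating.ι_mem_exteriorPower_one` (imported; not restated here).

/-- `ℓ_k ∧ m_k ∈ ⋀²`. -/
lemma LM_mem_pow (k : ℕ) : LM bV k ∈ ⋀[K]^2 V := by
  rw [LM, show (2 : ℕ) = 1 + 1 from rfl]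
  exact SetLike.mul_mem_graded (ι_mem_exteriorPower_one K _) (ι_mem_exteriorPower_one K _)

/-- the layer `Ecl δ_m k` is homogeneous of degree `2m`. -/
lemma layer_mem_pow : ∀ k m : ℕ, Ecl bV (fun j => if j = m then (1 : K) else 0) k ∈ ⋀[K]^(2 * m) V
  | 0, 0 => by rw [Ecl_delta_zero, mul_zero]; exact SetLike.one_mem_graded _
  | 0, m + 1 => by rw [Ecl, if_neg (by omega), map_zero]; exact Submodule.zero_mem _
  | k + 1, 0 => by rw [Ecl_delta_zero, mul_zero]; exact SetLike.one_mem_graded _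
  | k + 1, m + 1 => by
    rw [Ecl_delta_succ_succ]
    refine Submodule.add_mem _ (layer_mem_pow k (m + 1)) ?_
    rw [show 2 * (m + 1) = 2 + 2 * m by ring]
    exact SetLike.mul_mem_graded (LM_mem_pow bV k) (layer_mem_pow k m)

/-- `LMprod k ∈ ⋀^{2k}`. -/
lemma LMprod_mem_pow : ∀ k : ℕ, LMprod bV k ∈ ⋀[K]^(2 * k) V
  | 0 => by rw [LMprod, mul_zero]; exact SetLike.one_mem_graded _
  | k + 1 => by
    rw [LMprod, show 2 * (k + 1) = 2 + 2 * k by ring]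
    exact SetLike.mul_mem_graded (LM_mem_pow bV k) (LMprod_mem_pow k)

/-- `vac k ∈ ⋀^k`. -/
lemma vac_mem_pow : ∀ k : ℕ, vac bV k ∈ ⋀[K]^k V
  | 0 => by rw [vac]; exact SetLike.one_mem_graded _
  | k + 1 => by
    rw [vac, add_comm]
    exact SetLike.mul_mem_graded (ι_mem_exteriorPower_one K _) (vac_mem_pow k)

/-- `ellprod k ∈ ⋀^k`. -/
lemma ellprod_mem_pow : ∀ k : ℕ, ellprod bV k ∈ ⋀[K]^k V
  | 0 => by rw [ellprod]; exact SetLike.one_mem_graded _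
  | k + 1 => by
    rw [ellprod]
    exact SetLike.mul_mem_graded (ellprod_mem_pow k) (ι_mem_exteriorPower_one K _)

/-- `ellprodFrom p k ∈ ⋀^{k - p}`. -/
lemma ellprodFrom_mem_pow (p : ℕ) : ∀ k : ℕ, ellprodFrom bV p k ∈ ⋀[K]^(k - p) V
  | 0 => by rw [ellprodFrom, Nat.zero_sub]; exact SetLike.one_mem_graded _
  | k + 1 => by
    by_cases hk : p ≤ k
    · rw [ellprodFrom, if_pos hk, show k + 1 - p = (k - p) + 1 by omega]
      exact SetLike.mul_mem_graded (ellprodFrom_mem_pow p k) (ι_mem_exteriorPower_one K _)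
    · rw [ellprodFrom, if_neg hk, mul_one, show k + 1 - p = k - p by omega]
      exact ellprodFrom_mem_pow p k

/-- `vacFrom p k ∈ ⋀^{k - p}`. -/
lemma vacFrom_mem_pow (p : ℕ) : ∀ k : ℕ, vacFrom bV p k ∈ ⋀[K]^(k - p) V
  | 0 => by rw [vacFrom, Nat.zero_sub]; exact SetLike.one_mem_graded _
  | k + 1 => by
    by_cases hk : p ≤ k
    · rw [vacFrom, if_pos hk, show k + 1 - p = 1 + (k - p) by omega]
      exact SetLike.mul_mem_graded (ι_mem_exteriorPower_one K _) (vacFrom_mem_pow p k)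
    · rw [vacFrom, if_neg hk, one_mul, show k + 1 - p = k - p by omega]
      exact vacFrom_mem_pow p k

/-- `w₊ = wUp p ∈ ⋀^N` (`p ≤ N`). -/
lemma wUp_mem_pow {p : ℕ} (hp : p ≤ N) : wUp bV p ∈ ⋀[K]^N V := by
  have h := SetLike.mul_mem_graded (ellprodFrom_mem_pow bV p N) (vac_mem_pow bV p)
  rwa [show N - p + p = N by omega] at h

/-- `w₋ = wLow p ∈ ⋀^N` (`p ≤ N`). -/
lemma wLow_mem_pow {p : ℕ} (hp : p ≤ N) : wLow bV p ∈ ⋀[K]^N V := by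
  have h := SetLike.mul_mem_graded (ellprod_mem_pow bV p) (vacFrom_mem_pow bV p N)
  rwa [show p + (N - p) = N by omega] at h

/-- **the top-degree component of `Ecl Q N` is `Q_N · LMprod N`.** [cite: BourbakiAlgebre1a3, Ch. III §7 no. 8] -/
theorem proj_Ecl_top (Q : ℕ → K) :
    GradedAlgebra.proj (fun i : ℕ => ⋀[K]^i V) (N + N) (Ecl bV Q N) = Q N • LMprod bV N := by
  have htop : LMprod bV N ∈ ⋀[K]^(N + N) V := by simpa only [two_mul] using LMprod_mem_pow bV N
  have h0 : ∀ m ∈ Finset.range N, GradedAlgebra.proj (fun i : ℕ => ⋀[K]^i V) (N + N)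
      (Q m • Ecl bV (fun j => if j = m then (1 : K) else 0) N) = 0 := by
    intro m hm
    rw [Finset.mem_range] at hm
    rw [map_smul, GradedAlgebra.proj_apply, DirectSum.decompose_of_mem_ne (fun i : ℕ => ⋀[K]^i V) (layer_mem_pow bV N m) (by omega), smul_zero]
  rw [Ecl_eq_sum_layer, map_sum, Finset.sum_range_succ, Finset.sum_congr rfl h0, Finset.sum_const_zero, zero_add,
    Ecl_delta_top, map_smul, GradedAlgebra.proj_apply, DirectSum.decompose_of_mem_same (fun i : ℕ => ⋀[K]^i V) htop]

/-! ### 3. `Θ` kills the Weil vectors -/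

/-- `m_a ∧ (m_{k-1} ∧ ⋯ ∧ m_0) = 0` for `a < k`. -/
lemma ι_m_mul_vac {a : ℕ} : ∀ {k : ℕ}, a < k → ι K (mN bV a) * vac bV k = 0
  | 0, h => absurd h (Nat.not_lt_zero a)
  | k + 1, h => by
    by_cases hak : a = k
    · subst hak; rw [vac, ← mul_assoc, ExteriorAlgebra.ι_sq_zero, zero_mul]
    · have hc : ι K (mN bV a) * ι K (mN bV k) = -(ι K (mN bV k) * ι K (mN bV a)) :=
        eq_neg_of_add_eq_zero_left (ExteriorAlgebra.ι_add_mul_swap _ _)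
      rw [vac, ← mul_assoc, hc, neg_mul, mul_assoc, ι_m_mul_vac (by omega), mul_zero, neg_zero]

/-- `m_a ∧ (m_{k-1} ∧ ⋯ ∧ m_p) = 0` for `p ≤ a < k`. -/
lemma ι_m_mul_vacFrom {p a : ℕ} (hpa : p ≤ a) : ∀ {k : ℕ}, a < k → ι K (mN bV a) * vacFrom bV p k = 0
  | 0, h => absurd h (Nat.not_lt_zero a)
  | k + 1, h => by
    rw [vacFrom, if_pos (by omega)]
    by_cases hak : a = k
    · subst hak; rw [← mul_assoc, ExteriorAlgebra.ι_sq_zero, zero_mul]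
    · have hc : ι K (mN bV a) * ι K (mN bV k) = -(ι K (mN bV k) * ι K (mN bV a)) :=
        eq_neg_of_add_eq_zero_left (ExteriorAlgebra.ι_add_mul_swap _ _)
      rw [← mul_assoc, hc, neg_mul, mul_assoc, ι_m_mul_vacFrom hpa (by omega), mul_zero, neg_zero]

/-- `(ℓ_0 ∧ ⋯ ∧ ℓ_{k-1}) ∧ ℓ_a = 0` for `a < k`. -/
lemma ellprod_mul_ι_ℓ {a : ℕ} : ∀ {k : ℕ}, a < k → ellprod bV k * ι K (ℓN bV a) = 0
  | 0, h => absurd h (Nat.not_lt_zero a)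
  | k + 1, h => by
    by_cases hak : a = k
    · subst hak; rw [ellprod, mul_assoc, ExteriorAlgebra.ι_sq_zero, mul_zero]
    · have hc : ι K (ℓN bV k) * ι K (ℓN bV a) = -(ι K (ℓN bV a) * ι K (ℓN bV k)) :=
        eq_neg_of_add_eq_zero_left (ExteriorAlgebra.ι_add_mul_swap _ _)
      rw [ellprod, mul_assoc, hc, mul_neg, ← mul_assoc, ellprod_mul_ι_ℓ (by omega), zero_mul, neg_zero]

/-- `(ℓ_p ∧ ⋯ ∧ ℓ_{k-1}) ∧ ℓ_a = 0` for `p ≤ a < k`. -/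
lemma ellprodFrom_mul_ι_ℓ {p a : ℕ} (hpa : p ≤ a) : ∀ {k : ℕ}, a < k → ellprodFrom bV p k * ι K (ℓN bV a) = 0
  | 0, h => absurd h (Nat.not_lt_zero a)
  | k + 1, h => by
    rw [ellprodFrom, if_pos (by omega)]
    by_cases hak : a = k
    · subst hak; rw [mul_assoc, ExteriorAlgebra.ι_sq_zero, mul_zero]
    · have hc : ι K (ℓN bV k) * ι K (ℓN bV a) = -(ι K (ℓN bV a) * ι K (ℓN bV k)) :=
        eq_neg_of_add_eq_zero_left (ExteriorAlgebra.ι_add_mul_swap _ _)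
      rw [mul_assoc, hc, mul_neg, ← mul_assoc, ellprodFrom_mul_ι_ℓ hpa (by omega), zero_mul, neg_zero]

/-- **`(ℓ_a ∧ m_a) ∧ w₊ = 0`** for `a < N` (`m_a` meets the vacuum for `a < p`, `ℓ_a` meets the upper `ℓ`-block for
`a ≥ p`): «`h ∧ W₊ = 0`». [cite: BourbakiAlgebre1a3, Ch. III §7 no. 1] -/
theorem LM_mul_wUp {p a : ℕ} (ha : a < N) : LM bV a * wUp bV p = 0 := by
  by_cases hap : a < p
  · rw [wUp, ← mul_assoc, LM_comm bV a (ellprodFrom bV p N), mul_assoc, LM, mul_assoc, ι_m_mul_vac bV hap, mul_zero,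
      mul_zero]
  · have hp' : p ≤ a := Nat.le_of_not_lt hap
    rw [wUp, ← mul_assoc, LM_comm bV a (ellprodFrom bV p N), LM, ← mul_assoc (ellprodFrom bV p N),
      ellprodFrom_mul_ι_ℓ bV hp' ha, zero_mul, zero_mul]

/-- **`(ℓ_a ∧ m_a) ∧ w₋ = 0`** for `a < N`: «`h ∧ W₋ = 0`». [cite: BourbakiAlgebre1a3, Ch. III §7 no. 1] -/
theorem LM_mul_wLow {p a : ℕ} (ha : a < N) : LM bV a * wLow bV p = 0 := by
  by_cases hap : a < p
  · rw [wLow, ← mul_assoc, LM_comm bV a (ellprod bV p), LM, ← mul_assoc (ellprod bV p), ellprod_mul_ι_ℓ bV hap, zero_mul,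
      zero_mul]
  · have hp' : p ≤ a := Nat.le_of_not_lt hap
    rw [wLow, ← mul_assoc, LM_comm bV a (ellprod bV p), mul_assoc, LM, mul_assoc, ι_m_mul_vacFrom bV hp' ha, mul_zero,
      mul_zero]

/-- `Ecl Q k · w₊ = Q_0 · w₊` for `k ≤ N`: only the constant layer survives. -/
theorem Ecl_mul_wUp (p : ℕ) : ∀ (k : ℕ) (Q : ℕ → K), k ≤ N → Ecl bV Q k * wUp bV p = Q 0 • wUp bV p
  | 0, Q, _ => by rw [Ecl, Algebra.algebraMap_eq_smul_one, smul_mul_assoc, one_mul]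
  | k + 1, Q, hk => by
    rw [Ecl, add_mul, Ecl_mul_wUp p k Q (by omega), mul_assoc, Ecl_mul_wUp p k _ (by omega), mul_smul_comm,
      LM_mul_wUp bV (by omega), smul_zero, add_zero]

/-- `Ecl Q k · w₋ = Q_0 · w₋` for `k ≤ N`. -/
theorem Ecl_mul_wLow (p : ℕ) : ∀ (k : ℕ) (Q : ℕ → K), k ≤ N → Ecl bV Q k * wLow bV p = Q 0 • wLow bV p
  | 0, Q, _ => by rw [Ecl, Algebra.algebraMap_eq_smul_one, smul_mul_assoc, one_mul]
  | k + 1, Q, hk => by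
    rw [Ecl, add_mul, Ecl_mul_wLow p k Q (by omega), mul_assoc, Ecl_mul_wLow p k _ (by omega), mul_smul_comm,
      LM_mul_wLow bV (by omega), smul_zero, add_zero]

end Carrier

/-! ### 4. The top-degree part of `v^∨ · v` (Weil type `(n, n)`) -/

/-- **THE MUKAI PAIRING ON THE CARRIER (HRR-SPLIT before `∫`).** Weil type `(n,n)`, `n ≥ 1`, every field: for
`v = Ecl q (2n) + a·w₊ + b·w₋` and `v^∨ = Ecl q̃ (2n) + (-1)ⁿ·(a·w₊ + b·w₋)`, `q̃_m = (-1)^m q_m`, the degree-`4n` component of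
`v^∨ · v` is `(Σ_{j ≤ 2n} (-1)^j C(2n,j) q_j q_{2n-j} + 2ab) · LMprod (2n)` (`LMprod (2n) = Θ^{2n}/(2n)!`): the h-part contributes
`P_f(q)`, the cross terms vanish (`Θ ∧ w± = 0`), the Weil part contributes `(-1)ⁿ w ∧ w = 2ab · Θ^{2n}/(2n)!`.
[cite: BourbakiAlgebre1a3, Ch. III §7 no. 8] [cite: MumfordAV1970, §16] -/
theorem proj_mukaiDual_mul_top {n : ℕ} (bV : Basis (Fin ((n + n) + (n + n))) K V) (hn : 1 ≤ n) (q : ℕ → K) (a b : K) :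
    GradedAlgebra.proj (fun i : ℕ => ⋀[K]^i V) ((n + n) + (n + n))
        ((Ecl bV (fun m => (-1 : K) ^ m * q m) (n + n) + (-1 : K) ^ n • (a • wUp bV n + b • wLow bV n)) *
          (Ecl bV q (n + n) + a • wUp bV n + b • wLow bV n)) =
      ((∑ j ∈ Finset.range (n + n + 1), (-1 : K) ^ j * (((n + n).choose j : ℕ) : K) * (q j * q (n + n - j))) + 2 * (a * b)) •
        LMprod bV (n + n) := by
  have hnN : n ≤ n + n := Nat.le_add_right n n
  have hNN : n + n ≠ (n + n) + (n + n) := by omega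
  have hW : wUp bV n ∈ ⋀[K]^(n + n) V := wUp_mem_pow bV hnN
  have hW' : wLow bV n ∈ ⋀[K]^(n + n) V := wLow_mem_pow bV hnN
  -- the cross terms keep only the constant layer, which has degree `2n < 4n`
  have hcross1 : Ecl bV (fun m => (-1 : K) ^ m * q m) (n + n) * (a • wUp bV n + b • wLow bV n) =
      q 0 • (a • wUp bV n + b • wLow bV n) := by
    rw [mul_add, mul_smul_comm, mul_smul_comm, Ecl_mul_wUp bV n _ _ le_rfl, Ecl_mul_wLow bV n _ _ le_rfl]
    simp only [pow_zero, one_mul]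
    rw [smul_comm a (q 0), smul_comm b (q 0), ← smul_add]
  have hcross2 : (a • wUp bV n + b • wLow bV n) * Ecl bV q (n + n) = q 0 • (a • wUp bV n + b • wLow bV n) := by
    rw [← Ecl_comm, mul_add, mul_smul_comm, mul_smul_comm, Ecl_mul_wUp bV n _ _ le_rfl, Ecl_mul_wLow bV n _ _ le_rfl,
      smul_comm a (q 0), smul_comm b (q 0), ← smul_add]
  have hpU : GradedAlgebra.proj (fun i : ℕ => ⋀[K]^i V) ((n + n) + (n + n)) (wUp bV n) = 0 := by
    rw [GradedAlgebra.proj_apply, DirectSum.decompose_of_mem_ne (fun i : ℕ => ⋀[K]^i V) hW hNN]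
  have hpW : GradedAlgebra.proj (fun i : ℕ => ⋀[K]^i V) ((n + n) + (n + n)) (wLow bV n) = 0 := by
    rw [GradedAlgebra.proj_apply, DirectSum.decompose_of_mem_ne (fun i : ℕ => ⋀[K]^i V) hW' hNN]
  have htop : LMprod bV (n + n) ∈ ⋀[K]^((n + n) + (n + n)) V := by simpa only [two_mul] using LMprod_mem_pow bV (n + n)
  have hprojL : GradedAlgebra.proj (fun i : ℕ => ⋀[K]^i V) ((n + n) + (n + n)) (LMprod bV (n + n)) = LMprod bV (n + n) := by
    rw [GradedAlgebra.proj_apply, DirectSum.decompose_of_mem_same (fun i : ℕ => ⋀[K]^i V) htop]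
  have h2 : (-1 : K) ^ n * (2 * ((-1 : K) ^ n * (a * b))) = 2 * (a * b) := by
    rw [← mul_assoc, mul_comm ((-1 : K) ^ n) 2, mul_assoc, ← mul_assoc ((-1 : K) ^ n), ← pow_add, ← two_mul, pow_mul,
      neg_one_sq, one_pow, one_mul]
  -- expand and project
  rw [add_assoc (Ecl bV q (n + n)) (a • wUp bV n) (b • wLow bV n), add_mul,
    mul_add (Ecl bV (fun m => (-1 : K) ^ m * q m) (n + n)), smul_mul_assoc, mul_add (a • wUp bV n + b • wLow bV n),
    hcross1, hcross2, weil_sq_nn bV hn a b, Ecl_mul_Ecl]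
  simp only [map_add, map_smul, hpU, hpW, hprojL, proj_Ecl_top bV, smul_zero, add_zero, zero_add, smul_smul]
  rw [← add_smul, h2]
  congr 1
  congr 1
  exact Finset.sum_congr rfl fun j _ => by ring

end Summit.Ventures.HSemireg.WeilFrame

end
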